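import Summits.AtomisticToContinuum.Crystallization.Theorems.FrustratedLawDichotomyStrainedPatchHomXiWindow

/-!
# The MIRROR-CLOSED bond cap `BondCap9` and the radius twin of the XiWindow node (lens-5 g102; critic row 1629 ask (ii) «XI-RADIUS-TWIN»)

Two findings of the desk census KMIN-102 (memo `decomp-a2c-lens-5/g102/memo/NODE-g102.md` §2; scripts `g102/num/kmin102.py`, `tiscan102.py`,
`capfloor102.py`, `capenergy102.py`):

* **MIRROR-GAP.**  The landed zone `BondCap ℓ G` (`…HomXiWindow` §5) caps the three basal and the three UPPER interlayer reference bonds only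
  (`hcpShift`, `hcpShift − f₀`, `hcpShift − f₁`).  It is NOT closed under the lattice mirror `z ↦ −z`: the mirror member `G' = S G S` of a zone member is
  congruent to it (same shuffle problem, same energy) but `BondCap ℓ G'` caps the three LOWER bonds `hcpShift − f₂`, `hcpShift − f₂ − f₀`,
  `hcpShift − f₂ − f₁` of `G` instead — so the typed zone at `ℓ = 107/100` contains members whose longest nearest-neighbour bond is `1.0816`
  (`K_min = 1.49` there), although the XI-100 desk table («max bond») was computed with all twelve bonds.  The nine vectors below cover all twelve
  nearest-neighbour bond lengths of BOTH sublattices at zero shuffle (B-site bonds are the negatives of A-site bonds).  FIX: `BondCap9 ℓ := BondCap ℓ ∧`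
  the three lower bonds.
* **K-FLOOR.**  «`K_min ≥ 2.17σ₁`-per-unit-shuffle on the zone» is FALSE on `BondCap9 (107/100)` (hence on `BondCap (107/100)`): c-axis-stretched in-band
  members pushed to the cap (`e_xx = e_yy = −.08, e_zz = +.06`, `‖G − 1‖ = .117`) have `K_min = 1.09` (two-fold, in-plane), true-sphere force margin
  `0.74σ₁` at `r = 3/400` and `< 1σ₁` at every radius inside the Loewner reach `r ≤ .010`.  The cap must DROP.  K-floor / margin table
  (`min |F|/σ₁` on the sphere `‖ξ − ξ⋆‖ = r`, `r ∈ {3/400, 1/128, 1/112, 1/100}`):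
  `ℓ = 1.025: K 2.35 → 1.58 / 1.65 / 1.88 / 2.09` · `1.030: 2.16 → 1.46 / 1.52 / 1.73 / 1.93` · `1.035: 1.99 → 1.34 / 1.40 / 1.59 / 1.77` ·
  `1.040: 1.83 → 1.24 / 1.29 / 1.46 / 1.63` · `1.045: 1.69 → 1.14 / 1.18 / 1.35 / 1.50` · `1.070: 1.09 → .74 / .77 / .87 / .97`.
  Pass line `1.5σ₁` ⇒ `(ℓ, r) ∈ {(41/40, 3/400), (207/200, 1/112), (209/200, 1/100)}`; the excluded collar `BondCap (107/100) ∧ ¬BondCap9 ℓ` is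
  VALUE-disposable (U-far lever): minimum in-band energy excess on the cap surface `+.0060 = 3.75 m` (`ℓ = 1.025`), `+.0082 = 5.1 m` (`1.035`),
  `+.0106 = 6.6 m` (`1.045`) per site above `e(HZ00) = −0.712725`, `m = 1/625`.

RECOMMENDED RECORD (for the critic to rule): zone `BondCap9 (207/200)`, tube radius `r = 1/112` (margin `1.59σ₁`, `r` inside the h-cell Loewner bracket
`[.0078, .010)`, U-far entry `≥ 5.1 m`).  This file: §1 `BondCap9`, monotonicity, projection to `BondCap`; §2 the assembly at a general `(ℓ, r)` through the
tree's `homFloor_of_windowPieces`, the exact split of the complement piece `(H∣hcp, ¬BondCap9 ℓ)` into the U-far piece of record `(H∣hcp, ¬BondCap ℓ')`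
and the NEW collar piece `(H∣hcp, BondCap ℓ' ∧ ¬BondCap9 ℓ)`, and the recommended pin.  0 sorry · no new axiom · no `instance` · no `notation` ·
imports only the TREE file `…StrainedPatchHomXiWindow` (landable alone).
-/

namespace Summit.AtomisticToContinuum.Crystallization.Theorems.FrustratedLawDichotomyStrainedPatchHomXiWindowNine

open scoped BigOperators Classical
open Summit.AtomisticToContinuum.Crystallization.Theorems.FrustratedLawDichotomyRangeCut
open Summit.AtomisticToContinuum.Crystallization.Theorems.FrustratedLawDichotomyAveragingCut
open Summit.AtomisticToContinuum.Crystallization.Theorems.FrustratedLawDichotomyStrainedPatchHomSplit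
open Summit.AtomisticToContinuum.Crystallization.Theorems.FrustratedLawDichotomyStrainedPatchHomXiWindow

/-! ## §1. The nine-vector (twelve-bond) cap -/

/-- (piece) [route statement · this cell; NOT a literature fact] **`BondCap9 ℓ G`** — ALL TWELVE reference nearest-neighbour bonds of the hcp two-lattice at
zero shuffle have deformed length `≤ ℓ`: the six of `BondCap ℓ G` (three basal, three upper interlayer) AND the three LOWER interlayer bonds
`hcpShift − f₂`, `hcpShift − f₂ − f₀`, `hcpShift − f₂ − f₁` (`f = hexFrame`; each of unit length at `G = 1`).  Closed under the lattice mirror. -/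
def BondCap9 (ℓ : ℝ) (G : E3 →L[ℝ] E3) : Prop :=
  BondCap ℓ G ∧ ‖G (hcpShift - hexFrame 2)‖ ≤ ℓ ∧ ‖G (hcpShift - hexFrame 2 - hexFrame 0)‖ ≤ ℓ ∧ ‖G (hcpShift - hexFrame 2 - hexFrame 1)‖ ≤ ℓ

/-- `BondCap9` is monotone in the cap. [formal bookkeeping] -/
theorem BondCap9.mono {ℓ ℓ' : ℝ} {G : E3 →L[ℝ] E3} (h : BondCap9 ℓ G) (hle : ℓ ≤ ℓ') : BondCap9 ℓ' G :=
  ⟨h.1.mono hle, h.2.1.trans hle, h.2.2.1.trans hle, h.2.2.2.trans hle⟩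

/-- The nine-vector cap implies the six-vector cap of record. [formal bookkeeping] -/
theorem BondCap9.bondCap {ℓ : ℝ} {G : E3 →L[ℝ] E3} (h : BondCap9 ℓ G) : BondCap ℓ G := h.1

/-- Off the six-vector cap one is off the nine-vector cap. [formal bookkeeping] -/
theorem not_bondCap9_of_not_bondCap {ℓ ℓ' : ℝ} {G : E3 →L[ℝ] E3} (hle : ℓ ≤ ℓ') (h : ¬BondCap ℓ' G) : ¬BondCap9 ℓ G :=
  fun h9 => h (h9.bondCap.mono hle)

/-! ## §2. The assembly at a general `(ℓ, r)`, the split of the complement, the recommended pin -/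

/-- ★★ **ASSEMBLY at the mirror-closed zone**: `(H∣fcc) ∧ XiTube (BondCap9 ℓ) σ̂ r ∧ (H∣hcp, BondCap9 ℓ ∧ tube) ∧ (H∣hcp, ¬BondCap9 ℓ) ⟹ HomFloor (1/625)`
(the tree's `homFloor_of_windowPieces` at `Zone := BondCap9 ℓ`). [formal bookkeeping] -/
theorem homFloor_625_of_bondCap9Pieces (ℓ : ℝ) (σ : (E3 →L[ℝ] E3) → E3) (r : ℝ)
    (hF : HomFloorFcc (fun _ => True) (1 / 625)) (hT : XiTube (fun G _ => BondCap9 ℓ G) σ r)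
    (hE : HomFloorHcp (fun G ξ => BondCap9 ℓ G ∧ ‖ξ - σ G‖ ≤ r) (1 / 625))
    (hU : HomFloorHcp (fun G _ => ¬BondCap9 ℓ G) (1 / 625)) : HomFloor (1 / 625) :=
  homFloor_of_windowPieces (fun G => BondCap9 ℓ G) σ r hF hT hE hU

/-- ★ EXACT SPLIT OF THE COMPLEMENT PIECE: the floor off the nine-vector cap `ℓ` follows from the U-FAR floor of record (off the six-vector cap `ℓ'`;
meant for `ℓ ≤ ℓ'`, when the two zones are nested — `homFloorHcp_split_of_not_bondCap9`) together with the floor on the NEW COLLAR `BondCap ℓ' ∧ ¬BondCap9 ℓ` (value-disposable: KMIN-102 (d), excess `≥ 3.75 m … 6.6 m` per site for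
`ℓ ∈ [1.025, 1.045]`, `ℓ' = 107/100`). [`em`] -/
theorem homFloorHcp_not_bondCap9_of_split {ℓ ℓ' m : ℝ}
    (hFar : HomFloorHcp (fun G _ => ¬BondCap ℓ' G) m) (hCollar : HomFloorHcp (fun G _ => BondCap ℓ' G ∧ ¬BondCap9 ℓ G) m) :
    HomFloorHcp (fun G _ => ¬BondCap9 ℓ G) m := by
  refine (homFloorHcp_split (fun G _ => ¬BondCap9 ℓ G) (fun G _ => BondCap ℓ' G)).mpr ⟨?_, ?_⟩
  · exact hCollar.mono_zone fun _ _ hG => ⟨hG.2, hG.1⟩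
  · exact hFar.mono_zone fun _ _ hG => hG.2

/-- Conversely both halves follow from the complement piece (the split loses nothing). [formal bookkeeping] -/
theorem homFloorHcp_split_of_not_bondCap9 {ℓ ℓ' m : ℝ} (hle : ℓ ≤ ℓ') (h : HomFloorHcp (fun G _ => ¬BondCap9 ℓ G) m) :
    HomFloorHcp (fun G _ => ¬BondCap ℓ' G) m ∧ HomFloorHcp (fun G _ => BondCap ℓ' G ∧ ¬BondCap9 ℓ G) m :=
  ⟨h.mono_zone fun _ _ hG => not_bondCap9_of_not_bondCap hle hG, h.mono_zone fun _ _ hG => hG.2⟩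

/-- ★★ **THE RECOMMENDED RECORD (KMIN-102)**: zone `BondCap9 (207/200)`, tube radius `1/112`, U-far cap of record `107/100`:
`(H∣fcc) ∧ XiTube (BondCap9 1.035) σ̂ (1/112) ∧ (H∣hcp, BondCap9 1.035 ∧ tube) ∧ (H∣hcp, BondCap 1.07 ∧ ¬BondCap9 1.035) ∧ (H∣hcp, ¬BondCap 1.07)
⟹ HomFloor (1/625)`.  Desk: K-floor `1.99σ₁` per unit shuffle on the zone, true-sphere force margin `1.59σ₁` at `r = 1/112` (pass line `1.5σ₁`);
collar entry `≥ 5.1 m`; `r = 1/112 ∈ [.0078, .010)` (h-cell Loewner bracket of critic row 1629). [formal bookkeeping] -/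
theorem homFloor_625_of_bondCap9_record (σ : (E3 →L[ℝ] E3) → E3)
    (hF : HomFloorFcc (fun _ => True) (1 / 625)) (hT : XiTube (fun G _ => BondCap9 (207 / 200) G) σ (1 / 112))
    (hE : HomFloorHcp (fun G ξ => BondCap9 (207 / 200) G ∧ ‖ξ - σ G‖ ≤ 1 / 112) (1 / 625))
    (hCollar : HomFloorHcp (fun G _ => BondCap (107 / 100) G ∧ ¬BondCap9 (207 / 200) G) (1 / 625))
    (hFar : HomFloorHcp (fun G _ => ¬BondCap (107 / 100) G) (1 / 625)) : HomFloor (1 / 625) :=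
  homFloor_625_of_bondCap9Pieces (207 / 200) σ (1 / 112) hF hT hE (homFloorHcp_not_bondCap9_of_split hFar hCollar)

/-- The alternative pins of the KMIN-102 table, same shape: `(41/40, 3/400)` [margin `1.58σ₁`, entry `3.75 m`] … [formal bookkeeping] -/
theorem homFloor_625_of_bondCap9_alt (σ : (E3 →L[ℝ] E3) → E3)
    (hF : HomFloorFcc (fun _ => True) (1 / 625)) (hT : XiTube (fun G _ => BondCap9 (41 / 40) G) σ (3 / 400))
    (hE : HomFloorHcp (fun G ξ => BondCap9 (41 / 40) G ∧ ‖ξ - σ G‖ ≤ 3 / 400) (1 / 625))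
    (hCollar : HomFloorHcp (fun G _ => BondCap (107 / 100) G ∧ ¬BondCap9 (41 / 40) G) (1 / 625))
    (hFar : HomFloorHcp (fun G _ => ¬BondCap (107 / 100) G) (1 / 625)) : HomFloor (1 / 625) :=
  homFloor_625_of_bondCap9Pieces (41 / 40) σ (3 / 400) hF hT hE (homFloorHcp_not_bondCap9_of_split hFar hCollar)

/-- … and `(209/200, 1/100)` [margin `1.50σ₁` JUST, entry `6.6 m`]. [formal bookkeeping] -/
theorem homFloor_625_of_bondCap9_alt' (σ : (E3 →L[ℝ] E3) → E3)
    (hF : HomFloorFcc (fun _ => True) (1 / 625)) (hT : XiTube (fun G _ => BondCap9 (209 / 200) G) σ (1 / 100))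
    (hE : HomFloorHcp (fun G ξ => BondCap9 (209 / 200) G ∧ ‖ξ - σ G‖ ≤ 1 / 100) (1 / 625))
    (hCollar : HomFloorHcp (fun G _ => BondCap (107 / 100) G ∧ ¬BondCap9 (209 / 200) G) (1 / 625))
    (hFar : HomFloorHcp (fun G _ => ¬BondCap (107 / 100) G) (1 / 625)) : HomFloor (1 / 625) :=
  homFloor_625_of_bondCap9Pieces (209 / 200) σ (1 / 100) hF hT hE (homFloorHcp_not_bondCap9_of_split hFar hCollar)

/-- NECESSITY: every piece but the tube follows from `HomFloor (1/625)` (the cut loses nothing). [formal bookkeeping] -/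
theorem bondCap9Pieces_of_homFloor {m : ℝ} (h : HomFloor m) (ℓ ℓ' : ℝ) (σ : (E3 →L[ℝ] E3) → E3) (r : ℝ) :
    HomFloorFcc (fun _ => True) m ∧ HomFloorHcp (fun G ξ => BondCap9 ℓ G ∧ ‖ξ - σ G‖ ≤ r) m ∧
      HomFloorHcp (fun G _ => BondCap ℓ' G ∧ ¬BondCap9 ℓ G) m ∧ HomFloorHcp (fun G _ => ¬BondCap ℓ' G) m :=
  ⟨homFloorFcc_of_homFloor h _, homFloorHcp_of_homFloor h _, homFloorHcp_of_homFloor h _, homFloorHcp_of_homFloor h _⟩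

end Summit.AtomisticToContinuum.Crystallization.Theorems.FrustratedLawDichotomyStrainedPatchHomXiWindowNine
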